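/-
Literature anchor (engines group, cap lane, anchor #37): Moore's MEAN VALUE EXTENSION
`f(X) ⊆ f(m) + ∑ᵢ DᵢF(X)(Xᵢ − mᵢ)` (1979 §4.3 eq. (4.19)) applied to the time-`h` flow map
`x ↦ φ(h, x)` of a polynomial initial value problem with rational data, as a kernel-checkable
certificate: `DᵢF(X)` := the columns of the Jacobian end box `J1 ⊇ D_xφ(h, [W])` of the `C¹`
step certificate (`VariationalEnclosureCertificate.lean`), `f(m)` := the end box of a POINT
high-order-enclosure certificate from the centre `m ∈ W`; soundness = the set-valued mean value
theorem over the interval matrix `J1` (Mrozek–Zgliczyński 2000 Theorem 7.5, Neumaier 1990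
Cor. 5.1.5: `LipschitzMatrixOfJacobian.lean`) along an ad-hoc solution family through `W`.
Moore's Volterra example from the box `(1, 3) ± 0.01` replayed by `decide`: the mean-value box
is three times narrower than the direct Taylor enclosure of the same step.
-/
import Literature.Analysis.ODE.VariationalEnclosureCertificate
import Literature.Analysis.ValidatedNumerics.LipschitzMatrixOfJacobian
import HarnessLib

/-!
# Mean-value-form enclosure certificate for one `C¹` validated integration step

For `y' = P(y)` (`P` a vector of sparse rational polynomials, `fieldMv`), a box `W` of initial
values, a step `h` and an order `K`, the direct enclosure of `φ(h, W)` by the Taylor tube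
`∑_{j<K} hʲ Φⱼ(W) + h^K Φ_K(S)` (`HOEStepCert.endBox`) evaluates every coefficient polynomial
over the whole box `W` (dependency and wrapping, Moore 1979 §8.2).  Moore's **mean value
extension** (1979 §4.3 eq. (4.19)): for `f ∈ C¹` on a box `X` with centre `m` and interval
extensions `DᵢF(X) ∋ ∂f/∂xᵢ(X)`,

  `f(X) ⊆ F_MV(X) = f(m) + ∑ᵢ DᵢF(X) · (Xᵢ − mᵢ)`,

applied to `f = φ(h, ·)` on `X = W`, is the evaluation step of a `C¹` (Lohner-type) validated
integrator (Zgliczyński 2002 §3; Mrozek–Zgliczyński 2000 Theorem 7.5 `f(x + h) ⊂ f(x) +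
J_{x+h}f · h`): here `DᵢF(W)` is column `i` of the Jacobian end box `J1 ⊇ D_xφ(h, [W])`
certified by the `C¹` step certificate `VarStepCert` (`hasFDerivWithinAt_flow_step`), and `f(m)`
is enclosed by the end box of a point `HOEStepCert` from the rational centre `m`.

## Contents

* `imatvecQ`, `castBox_imatvecQ`, `mulVec_mem_imatvecQ` — rational interval matrix × interval
  vector, representing `imatmul` (column count `Unit`), with Neumaier's inclusion property;
  `shiftBox W m = W − m`, `mvBoxQ P J W m = P + J · (W − m)` with `meanValue_mem_mvBoxQ`
  (`p ∈ P`, `M ∈ J`, `x ∈ W` ⇒ `p + M (x − m) ∈ mvBoxQ`); `pointBox`; `meetIv` / `meetBox`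
  (componentwise intersection with a sound fallback) and `mem_meetBox`.
* `MVStepCert n` = a `VarStepCert n` (field, order, step, init `W`, a-priori boxes `S`, `VV`)
  plus a rational `center`, `centerOrder` and `centerApriori`; `pointCert` (the point HOE
  certificate from the centre); the Boolean `check` (the `C¹` check, `posBox S`, `m ∈ W`, the
  point check); `mvEndBox = pointCert.endBox + J1 · (W − m)`; `bestEndBox = mvEndBox ∩ endBox`.
* `MVStepCert.meanValue` — THE MEAN VALUE FORM OF THE FLOW: if `check` accepts, then for every
  `x ∈ W` and every solution `z` from `x` on `[0, h]` there are a solution `z_c` from the centre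
  and a real matrix `M ∈ J1` with `z(h) = z_c(h) + M (x − m)`.
* `MVStepCert.sound` — `z(h) ∈ mvEndBox` and `z(h) ∈ endBox`; `mem_bestEndBox`;
  `exists_of_check` (existence on `[0, h]` from every `x ∈ W`).
* `mvStepVerifier n : Verifier (MVInstance n) MVInstance.Claim` — certificates = the boxes and
  the centre data (`MVCertData`), claim = existence plus `φ(h, W) ⊆ final`.
* KERNEL EXAMPLE `mooreVolterraMV`: Moore's Volterra system (8.6) from the box
  `W = [0.99, 1.01] × [2.99, 3.01]`, `h = 1/8`, `K = 6`, centre `(1, 3)`: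
  `mooreVolterraMV_check` (by `decide`), `mooreVolterraMV_mvEndBox_le`
  (`φ(1/8, W) ⊆ [0.5978, 0.6237] × [2.9068, 2.9363]`, widths `0.026`, `0.030`),
  `mooreVolterraMV_directEndBox_ge` (the direct Taylor enclosure of the same step contains
  `[0.5687, 0.6529] × [2.8975, 2.9456]`, widths `≥ 0.084`, `0.048`), `mooreVolterraMV_sound`,
  `mooreVolterraMV_claim` (the verifier's claim extracted by `decide`).

## Soundness chain

`check` ⇒ (`VarStepCert.check`) the state HOE certificate holds on `W`, so every `x' ∈ W`
carries a solution on `[0, h]` staying in `S` (`HOEStepCert.sound`); choosing one solution per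
point and the GIVEN solution `z` at `x` yields an `IsSolutionFamily` through `W`
(`exists_solutionFamily_through`); `VarStepCert.hasFDerivWithinAt_flow_step` (needs `posBox S`)
gives `HasFDerivWithinAt (x' ↦ u x' h) J(x') W x'` with `J(x') ∈ J1` entrywise for every
`x' ∈ W`; `exists_matrixIcc_meanValue_of_hasFDerivWithinAt` (convexity of `W`, row-wise mean
value theorem) gives `u x h = u m h + M (x − m)` with `M ∈ [J1]`; `u m` is a solution from the
centre, so `u m h ∈ pointCert.endBox` (`HOEStepCert.mem_endBox`), and interval arithmetic
(`meanValue_mem_mvBoxQ`) finishes.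

## Honest limits (stated, not hidden)

* The mean value form is second order in `w(W)` but NOT always narrower than the direct box:
  for wide `W` it can be wider (Moore 1979 §4.3, remark after (4.25)); hence `bestEndBox`
  intersects the two.  No coordinate change / QR rearrangement (Lohner; Mrozek–Zgliczyński 2000
  §8) is performed: in a chain of such steps the wrapping effect still accumulates in `W`.
* `J1` comes from `VariationalEnclosureCertificate.lean`, whose remainder factor
  `ψ^[K](0,[S],Id)` is evaluated in expanded monomial form (coarse); `J1`'s excess width enters
  `mvEndBox` multiplied by `w(W)/2` only.
* Single step, autonomous polynomial fields with rational coefficients, exact rational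
  arithmetic (the abstract machine of Moore 1966 §4.4); floating point with directed rounding is
  an untrusted front end that must reproduce these rational bounds.

## References

* R. E. Moore, *Methods and Applications of Interval Analysis*, SIAM 1979: §4.3 eq. (4.19) (mean
  value extension `F_MV(X) = f(m) + ∑ DᵢF(X)(Xᵢ − mᵢ) ⊇ f(X)`), §8.1 (8.6)–(8.13) (Volterra
  example, Taylor enclosures), §8.2 item 1 (`S_t ⊆ y*(t) + M(t)Z(t)`, the wrapping effect).
  [held: lit key book:moorend-methods-applications-interval-analysis, chunks 43–45, 80–84]
  [Moore1979]
* M. Mrozek, P. Zgliczyński, *Set arithmetic and the enclosing problem in dynamics*, Ann. Polon.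
  Math. 74 (2000): Theorem 7.5 (set-valued mean value theorem `f(x + h) ⊂ f(x) + J_{x+h}f · h`),
  §8 (rearrangement, Lohner's method). [held: lit key paper:doi-10-4064-ap-74-1-237-259, p. 248]
  [MrozekZgliczynski2000]
* A. Neumaier, *Interval Methods for Systems of Equations*, Cambridge UP 1990: Cor. 5.1.5 (mean
  value form over an interval matrix of partial derivatives), §3.1 Proposition 3.1.2 (6)–(7).
  [Neumaier1991]
* P. Zgliczyński, *C¹ Lohner algorithm*, Found. Comput. Math. 2 (2002): §3 (one step: enclosure
  of `∂φ/∂x(h,[x])` and evaluation `φ(h,[x]) ⊂ Φ(h, m) + ∂Φ/∂x(h,[x])([x] − m)`).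
  [Zgliczynski2002C1Lohner]
* I. Walawska, D. Wilczak, *An implicit algorithm for validated enclosures of the solutions to
  variational equations for ODEs*, Appl. Math. Comput. 291 (2016): §2 (a step = rough enclosure,
  then tighter bounds `[x_{k+1}] ⊇ φ(t_k + h_k, [x_0])`), §2.1 (`C¹` high-order enclosure).
  [held: lit key paper:arxiv-1509.07388, p. 5] [WalawskaWilczak2016]
* N. S. Nedialkov, K. R. Jackson, G. F. Corliss, *Validated solutions of initial value problems
  for ordinary differential equations*, Appl. Math. Comput. 105 (1999), §5 Algorithm I / II
  (validate, then tighten). [NedialkovJacksonCorliss1999]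
* R. E. Moore, *Interval Analysis*, Prentice-Hall 1966, §4.4 (exact rational interval arithmetic
  as the machine model of a checker). [Moore1966]
-/

open Set NonemptyInterval Matrix
open Literature.Analysis.ValidatedNumerics

namespace Literature.Analysis.ODE

/-! ### Rational interval matrix–vector products and the mean value box -/

section MeanValueBox

variable {n : ℕ}

/-- The **rational interval matrix–vector product** `(A·B)ᵢ = ∑ₗ Aᵢₗ · Bₗ` (scalar Moore
products, exact interval sums over the list of indices, kernel-reducible).
[cite: Neumaier1991, §3.1 Proposition 3.1.2 (6)] -/
def imatvecQ (A : Fin n → Fin n → NonemptyInterval ℚ) (B : Fin n → NonemptyInterval ℚ) :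
    Fin n → NonemptyInterval ℚ :=
  fun i => ((List.finRange n).map fun l => (A i l).mooreMul (B l)).sum

/-- The rational interval matrix–vector product represents the real interval matrix product
`imatmul` with a one-column right factor. [cite: Neumaier1991, §3.1 Proposition 3.1.2 (6)] -/
theorem castBox_imatvecQ (A : Fin n → Fin n → NonemptyInterval ℚ) (B : Fin n → NonemptyInterval ℚ)
    (i : Fin n) :
    castBox (imatvecQ A B) i = imatmul (castMat A) (fun l (_ : Unit) => castBox B l) i () := by
  simp only [castBox_apply, castMat_apply, imatvecQ, imatmul]
  rw [ratCast_listSum, List.map_map, Fin.sum_univ_def]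
  congr 1
  refine List.map_congr_left fun l _ => ?_
  simp only [Function.comp_apply, ratCast_mooreMul]

/-- **Inclusion property** of the matrix–vector product: `M ∈ A` entrywise and `v ∈ B`
componentwise imply `(M v)ᵢ ∈ (A·B)ᵢ`. [cite: Neumaier1991, §3.1 Proposition 3.1.2 (6)] -/
theorem mulVec_mem_imatvecQ {A : Fin n → Fin n → NonemptyInterval ℚ}
    {B : Fin n → NonemptyInterval ℚ} {M : Matrix (Fin n) (Fin n) ℝ} {v : Fin n → ℝ}
    (hM : ∀ i l, M i l ∈ castMat A i l) (hv : ∀ l, v l ∈ castBox B l) (i : Fin n) :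
    (M *ᵥ v) i ∈ castBox (imatvecQ A B) i := by
  rw [castBox_imatvecQ]
  exact matmul_mem_imatmul (B := fun l (_ : Unit) => castBox B l) (b := fun l (_ : Unit) => v l)
    hM (fun l _ => hv l) i ()

/-- The shifted box `W − m` (component `l` is `Wₗ + [−mₗ, −mₗ]`).
[cite: Moore1979, §4.3 eq. (4.19) (the factor Xᵢ − mᵢ)] -/
def shiftBox (W : Fin n → NonemptyInterval ℚ) (m : Fin n → ℚ) : Fin n → NonemptyInterval ℚ :=
  fun l => W l + pure (-m l)

/-- `x ∈ W` ⇒ `xₗ − mₗ ∈ (W − m)ₗ`. [cite: Moore1979, §4.3 eq. (4.19) (the factor Xᵢ − mᵢ)] -/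
theorem sub_mem_shiftBox {W : Fin n → NonemptyInterval ℚ} {m : Fin n → ℚ} {x : Fin n → ℝ}
    (hx : x ∈ boxSet (castBox W)) (l : Fin n) :
    x l - (m l : ℝ) ∈ castBox (shiftBox W m) l := by
  simp only [castBox_apply, shiftBox, QMvPoly.ratCast_add, ratCast_pure, Rat.cast_neg]
  rw [sub_eq_add_neg]
  exact add_mem_add' ((mem_boxSet_iff.1 hx) l) (mem_pure_self _)

/-- **Moore's mean value box** `P + J · (W − m)`: component `i` is `Pᵢ + ∑ₗ Jᵢₗ (Wₗ − mₗ)`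
(`P ∋ f(m)`, `J ⊇` the partial derivatives over `W`). [cite: Moore1979, §4.3 eq. (4.19)] -/
def mvBoxQ (P : Fin n → NonemptyInterval ℚ) (J : Fin n → Fin n → NonemptyInterval ℚ)
    (W : Fin n → NonemptyInterval ℚ) (m : Fin n → ℚ) : Fin n → NonemptyInterval ℚ :=
  fun i => P i + imatvecQ J (shiftBox W m) i

/-- **The mean value box encloses the mean value form**: `p ∈ P`, `M ∈ J` entrywise and `x ∈ W`
imply `p + M (x − m) ∈ P + J · (W − m)` (interval arithmetic: Moore 1979 (4.19) with
Neumaier's inclusion property of the matrix–vector product). [cite: Moore1979, §4.3 eq. (4.19)]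
[cite: Neumaier1991, §3.1 Proposition 3.1.2 (6)] -/
theorem meanValue_mem_mvBoxQ {P : Fin n → NonemptyInterval ℚ}
    {J : Fin n → Fin n → NonemptyInterval ℚ} {W : Fin n → NonemptyInterval ℚ} {m : Fin n → ℚ}
    {p x : Fin n → ℝ} {M : Matrix (Fin n) (Fin n) ℝ} (hp : p ∈ boxSet (castBox P))
    (hM : ∀ i l, M i l ∈ castMat J i l) (hx : x ∈ boxSet (castBox W)) :
    p + M *ᵥ (x - fun l => (m l : ℝ)) ∈ boxSet (castBox (mvBoxQ P J W m)) := by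
  rw [mem_boxSet_iff]
  intro i
  simp only [castBox_apply, mvBoxQ, QMvPoly.ratCast_add, Pi.add_apply]
  refine add_mem_add' ((mem_boxSet_iff.1 hp) i) ?_
  have hv : ∀ l, (x - fun l => (m l : ℝ)) l ∈ castBox (shiftBox W m) l :=
    fun l => sub_mem_shiftBox hx l
  exact mulVec_mem_imatvecQ hM hv i

/-- The point box `[m, m]` of a rational vector. [cite: Moore1979, §2.2 (degenerate intervals)] -/
def pointBox (m : Fin n → ℚ) : Fin n → NonemptyInterval ℚ :=
  fun l => pure (m l)

/-- The rational vector `m` (as a real vector) lies in its point box.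
[cite: Moore1979, §2.2 (degenerate intervals)] -/
theorem ratVec_mem_pointBox (m : Fin n → ℚ) :
    (fun l => (m l : ℝ)) ∈ boxSet (castBox (pointBox m)) := by
  rw [mem_boxSet_iff]
  intro l
  simp only [castBox_apply, pointBox, ratCast_pure]
  exact mem_pure_self _

/-- If `[m, m] ≤ W` (decidable), the real vector `m` lies in the box `W`.
[cite: Moore1979, §4.3 eq. (4.19) (m = m(X) ∈ X)] -/
theorem ratVec_mem_of_boxLE {m : Fin n → ℚ} {W : Fin n → NonemptyInterval ℚ}
    (h : boxLE (pointBox m) W = true) : (fun l => (m l : ℝ)) ∈ boxSet (castBox W) :=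
  boxSet_mono (castBox_mono (le_of_boxLE h)) (ratVec_mem_pointBox m)

/-- **Intersection of two rational intervals with a sound fallback**: `[max lo, min hi]` when
that is an interval, else the first argument (the case never met when both contain a common
point). [cite: Moore1979, §2.2 (intersection of intervals)] -/
def meetIv (I J : NonemptyInterval ℚ) : NonemptyInterval ℚ :=
  if h : max I.fst J.fst ≤ min I.snd J.snd then ⟨(max I.fst J.fst, min I.snd J.snd), h⟩ else I

/-- A real number lying in both intervals lies in `meetIv`.
[cite: Moore1979, §2.2 (intersection of intervals)] -/
theorem mem_meetIv {I J : NonemptyInterval ℚ} {x : ℝ} (hI : x ∈ I.ratCast ℝ)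
    (hJ : x ∈ J.ratCast ℝ) : x ∈ (meetIv I J).ratCast ℝ := by
  unfold meetIv
  split_ifs with h
  · refine mem_ratCast_iff.2 ⟨?_, ?_⟩
    · show ((max I.fst J.fst : ℚ) : ℝ) ≤ x
      rw [Rat.cast_max]
      exact max_le (mem_ratCast_iff.1 hI).1 (mem_ratCast_iff.1 hJ).1
    · show x ≤ ((min I.snd J.snd : ℚ) : ℝ)
      rw [Rat.cast_min]
      exact le_min (mem_ratCast_iff.1 hI).2 (mem_ratCast_iff.1 hJ).2
  · exact hI

/-- Componentwise intersection of two boxes (with the sound fallback of `meetIv`).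
[cite: Moore1979, §2.2 (intersection of intervals)] -/
def meetBox (A B : Fin n → NonemptyInterval ℚ) : Fin n → NonemptyInterval ℚ :=
  fun i => meetIv (A i) (B i)

/-- A real vector lying in both boxes lies in their `meetBox`.
[cite: Moore1979, §2.2 (intersection of intervals)] -/
theorem mem_meetBox {A B : Fin n → NonemptyInterval ℚ} {x : Fin n → ℝ}
    (hA : x ∈ boxSet (castBox A)) (hB : x ∈ boxSet (castBox B)) :
    x ∈ boxSet (castBox (meetBox A B)) := by
  rw [mem_boxSet_iff] at hA hB ⊢
  exact fun i => mem_meetIv (hA i) (hB i)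

/-- **A solution family through a box containing a prescribed solution**: if every point of
`W` carries a solution on `[0, T]` and every solution from `W` stays in `S`, then for any given
solution `z` from `x ∈ W` there is an `IsSolutionFamily` on `W` whose member at `x` is `z`
(one solution chosen per point; no uniqueness needed). [folklore] -/
private theorem exists_solutionFamily_through {F : (Fin n → ℝ) → Fin n → ℝ}
    {W S : Set (Fin n → ℝ)} {T : ℝ}
    (hex : ∀ x' ∈ W, ∃ y : ℝ → Fin n → ℝ, y 0 = x' ∧
      ∀ t ∈ Icc 0 T, HasDerivWithinAt y (F (y t)) (Icc 0 T) t)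
    (henc : ∀ x' ∈ W, ∀ y : ℝ → Fin n → ℝ, y 0 = x' →
      (∀ t ∈ Icc 0 T, HasDerivWithinAt y (F (y t)) (Icc 0 T) t) → ∀ t ∈ Icc 0 T, y t ∈ S)
    {x : Fin n → ℝ} (hx : x ∈ W) {z : ℝ → Fin n → ℝ} (hz0 : z 0 = x)
    (hz : ∀ t ∈ Icc 0 T, HasDerivWithinAt z (F (z t)) (Icc 0 T) t) :
    ∃ u : (Fin n → ℝ) → ℝ → Fin n → ℝ, IsSolutionFamily F S W T u ∧ u x = z := by
  classical
  choose y hy0 hy using hex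
  obtain ⟨u, hu⟩ : ∃ u : (Fin n → ℝ) → ℝ → Fin n → ℝ,
      u = fun x' => if x' = x then z else if h' : x' ∈ W then y x' h' else fun _ => x' :=
    ⟨_, rfl⟩
  have hux : u x = z := by
    rw [hu]
    exact if_pos rfl
  have hun : ∀ x' (h' : x' ∈ W), x' ≠ x → u x' = y x' h' := by
    intro x' h' hne
    rw [hu]
    exact (if_neg hne).trans (dif_pos h')
  refine ⟨u, ⟨?_, ?_, ?_⟩, hux⟩
  · intro x' hx'
    by_cases hxx : x' = x
    · rw [hxx, hux, hz0]
    · rw [hun x' hx' hxx]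
      exact hy0 x' hx'
  · intro x' hx' τ hτ
    by_cases hxx : x' = x
    · rw [hxx, hux]
      exact hz τ hτ
    · rw [hun x' hx' hxx]
      exact hy x' hx' τ hτ
  · intro x' hx' τ hτ
    by_cases hxx : x' = x
    · rw [hxx, hux]
      exact henc x hx z hz0 hz τ hτ
    · rw [hun x' hx' hxx]
      exact henc x' hx' _ (hy0 x' hx') (hy x' hx') τ hτ

end MeanValueBox

/-! ### The mean value step certificate -/

section Certificate

variable {n : ℕ}

/-- **Certificate for one mean-value-form (`C¹`, Lohner-type) step** of `y' = P(y)` from the box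
`W`: a `C¹` step certificate (field, order `K`, step `h`, `W`, a-priori boxes `S ⊇ y([0,h])`
and `VV ⊇ V([0,h])`) together with a rational centre `m ∈ W` and the data of a point Taylor
enclosure from `m` (its order and a-priori box). [cite: Moore1979, §4.3 eq. (4.19)]
[cite: Zgliczynski2002C1Lohner, §3 (C¹-Lohner algorithm: the enclosure of ∂φ/∂x(h,[x]))] -/
structure MVStepCert (n : ℕ) extends VarStepCert n where
  /-- The centre `m` (a rational point of `W`, typically its midpoint). -/
  center : Fin n → ℚ
  /-- The order of the point Taylor enclosure from the centre. -/
  centerOrder : ℕ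
  /-- The claimed a-priori enclosure of the solution from the centre over the whole step. -/
  centerApriori : Fin n → NonemptyInterval ℚ

namespace MVStepCert

variable (c : MVStepCert n)

/-- The centre as a real vector. [cite: Moore1979, §4.3 eq. (4.19) (m = m(X))] -/
noncomputable def centerVec : Fin n → ℝ :=
  fun l => (c.center l : ℝ)

/-- The point high-order-enclosure certificate from the centre (same field and step).
[cite: Moore1979, §8.1 eq. (8.13)] -/
def pointCert : HOEStepCert n :=
  ⟨c.field, c.centerOrder, c.step, pointBox c.center, c.centerApriori⟩

/-- **The checker**: the `C¹` step certificate accepts (state and variational HOE tests), the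
a-priori state box is non-degenerate, the centre lies in `W`, and the point certificate from the
centre accepts. [cite: Moore1979, §4.3 eq. (4.19)]
[cite: WalawskaWilczak2016, §2.1 (C¹ high-order enclosure)] -/
def check : Bool :=
  c.toVarStepCert.check && posBox c.apriori && boxLE (pointBox c.center) c.init &&
    c.pointCert.check

/-- **The mean value end box** `F_MV(W) = endBox(m) + J1 · (W − m)` for the flow map `φ(h, ·)`.
[cite: Moore1979, §4.3 eq. (4.19)]
[cite: Zgliczynski2002C1Lohner, §3 (C¹-Lohner algorithm: the enclosure of ∂φ/∂x(h,[x]))] -/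
def mvEndBox : Fin n → NonemptyInterval ℚ :=
  mvBoxQ c.pointCert.endBox c.jacEndBox c.init c.center

/-- The componentwise intersection of the mean value end box with the direct Taylor end box of
the step (both enclose `φ(h, W)`; for wide `W` the mean value form may be the wider one).
[cite: Moore1979, §4.3 (remark after eq. (4.25))] -/
def bestEndBox : Fin n → NonemptyInterval ℚ :=
  meetBox c.mvEndBox c.toHOE.endBox

variable {c}

/-- An accepted certificate contains an accepted `C¹` step certificate.
[cite: WalawskaWilczak2016, §2.1 (C¹ high-order enclosure)] -/
theorem check_var (hc : c.check = true) : c.toVarStepCert.check = true := by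
  simp only [check, Bool.and_eq_true] at hc
  exact hc.1.1.1

/-- An accepted certificate has a non-degenerate a-priori state box.
[cite: Neumaier1991, §3.1 (int A)] -/
theorem check_posBox (hc : c.check = true) : posBox c.apriori = true := by
  simp only [check, Bool.and_eq_true] at hc
  exact hc.1.1.2

/-- An accepted certificate has its centre in `W`. [cite: Moore1979, §4.3 eq. (4.19) (m ∈ X)] -/
theorem check_center (hc : c.check = true) : boxLE (pointBox c.center) c.init = true := by
  simp only [check, Bool.and_eq_true] at hc
  exact hc.1.2

/-- An accepted certificate contains an accepted point certificate from the centre.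
[cite: Moore1979, §8.1 eq. (8.10)] -/
theorem check_point (hc : c.check = true) : c.pointCert.check = true := by
  simp only [check, Bool.and_eq_true] at hc
  exact hc.2

/-- An accepted certificate contains an accepted state HOE certificate on `W`.
[cite: Moore1979, §8.1 eq. (8.10)] -/
theorem check_toHOE (hc : c.check = true) : c.toHOE.check = true := by
  have h := check_var hc
  simp only [VarStepCert.check, Bool.and_eq_true] at h
  rw [VarStepCert.toHOE_check]
  exact h.1

/-- The centre (as a real vector) lies in `W`. [cite: Moore1979, §4.3 eq. (4.19) (m ∈ X)] -/
theorem centerVec_mem (hc : c.check = true) : c.centerVec ∈ boxSet (castBox c.init) :=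
  ratVec_mem_of_boxLE (check_center hc)

/-- **Existence**: if the checker accepts, every `x ∈ W` carries a solution of `y' = P(y)` on
`[0, h]`. [cite: Moore1979, §8.1 eq. (8.10)]
[cite: NedialkovJacksonPryce2001, §3 (constant / Taylor a-priori enclosure)] -/
theorem exists_of_check (hc : c.check = true) {x : Fin n → ℝ}
    (hx : x ∈ boxSet (castBox c.init)) :
    ∃ y : ℝ → Fin n → ℝ, y 0 = x ∧
      ∀ t ∈ Icc 0 (c.step : ℝ),
        HasDerivWithinAt y (evalVec (fieldMv c.field) (y t)) (Icc 0 (c.step : ℝ)) t :=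
  (HOEStepCert.sound (check_toHOE hc) hx).1

/-- **THE MEAN VALUE FORM OF THE FLOW MAP** (Moore 1979 (4.19) for `f = φ(h, ·)`;
Mrozek–Zgliczyński 2000 Theorem 7.5): if the checker accepts, then for every `x ∈ W` and every
solution `z` of `y' = P(y)` from `x` on `[0, h]` there are a solution `z_c` from the centre `m`
on `[0, h]` and a real matrix `M` with entries in the certified Jacobian end box `J1` such that
`z(h) = z_c(h) + M (x − m)`.  Proof: a solution family through `W` containing `z`,
`VarStepCert.hasFDerivWithinAt_flow_step`, and the row-wise mean value theorem over the convex
box `W` (`exists_matrixIcc_meanValue_of_hasFDerivWithinAt`). [cite: Moore1979, §4.3 eq. (4.19)]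
[cite: MrozekZgliczynski2000, Theorem 7.5] [cite: Neumaier1991, Cor. 5.1.5] -/
theorem meanValue (hc : c.check = true) {x : Fin n → ℝ} (hx : x ∈ boxSet (castBox c.init))
    {z : ℝ → Fin n → ℝ} (hz0 : z 0 = x)
    (hz : ∀ t ∈ Icc 0 (c.step : ℝ),
      HasDerivWithinAt z (evalVec (fieldMv c.field) (z t)) (Icc 0 (c.step : ℝ)) t) :
    ∃ zc : ℝ → Fin n → ℝ, zc 0 = c.centerVec ∧
      (∀ t ∈ Icc 0 (c.step : ℝ),
        HasDerivWithinAt zc (evalVec (fieldMv c.field) (zc t)) (Icc 0 (c.step : ℝ)) t) ∧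
      ∃ M : Matrix (Fin n) (Fin n) ℝ, (∀ i l, M i l ∈ castMat c.jacEndBox i l) ∧
        z c.step = zc c.step + M *ᵥ (x - c.centerVec) := by
  have hcV := check_var hc
  have hpos := check_posBox hc
  have h1 := check_toHOE hc
  have hcW := centerVec_mem hc
  have hex : ∀ x' ∈ boxSet (castBox c.init), ∃ y : ℝ → Fin n → ℝ, y 0 = x' ∧
      ∀ t ∈ Icc 0 (c.step : ℝ),
        HasDerivWithinAt y (evalVec (fieldMv c.field) (y t)) (Icc 0 (c.step : ℝ)) t :=
    fun x' hx' => (HOEStepCert.sound h1 hx').1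
  have henc : ∀ x' ∈ boxSet (castBox c.init), ∀ y : ℝ → Fin n → ℝ, y 0 = x' →
      (∀ t ∈ Icc 0 (c.step : ℝ),
        HasDerivWithinAt y (evalVec (fieldMv c.field) (y t)) (Icc 0 (c.step : ℝ)) t) →
      ∀ t ∈ Icc 0 (c.step : ℝ), y t ∈ boxSet (castBox c.apriori) :=
    fun x' hx' y hy0 hy t ht => ((HOEStepCert.sound h1 hx').2 y hy0 hy t ht).1
  obtain ⟨u, hu, hux⟩ := exists_solutionFamily_through hex henc hx hz0 hz
  have hF : ∀ x' ∈ boxSet (castBox c.init), ∃ J : (Fin n → ℝ) →L[ℝ] (Fin n → ℝ),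
      HasFDerivWithinAt (fun x'' => u x'' c.step) J (boxSet (castBox c.init)) x' ∧
        ∀ i l, J (Pi.single l 1) i ∈ castMat c.jacEndBox i l :=
    fun x' hx' => VarStepCert.hasFDerivWithinAt_flow_step hcV hpos hu hx'
  choose! Jf hJf hJmem using hF
  have hA : ∀ x' ∈ boxSet (castBox c.init), ∀ i l,
      (fun i l => ((c.jacEndBox i l).fst : ℝ)) i l ≤ Jf x' (Pi.single l 1) i ∧
        Jf x' (Pi.single l 1) i ≤ (fun i l => ((c.jacEndBox i l).snd : ℝ)) i l :=
    fun x' hx' i l => mem_ratCast_iff.1 (hJmem x' hx' i l)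
  obtain ⟨M, hM, hMeq⟩ := exists_matrixIcc_meanValue_of_hasFDerivWithinAt
    (F := fun x'' => u x'' c.step) (convex_boxSet (castBox c.init)) hJf hA hx hcW
  have hM' : ∀ i l, ((c.jacEndBox i l).fst : ℝ) ≤ M i l ∧ M i l ≤ ((c.jacEndBox i l).snd : ℝ) :=
    hM
  refine ⟨u c.centerVec, hu.init _ hcW, hu.hasDerivWithinAt _ hcW, M,
    fun i l => mem_ratCast_iff.2 (hM' i l), ?_⟩
  rw [← hux]
  exact hMeq

/-- **Soundness of the mean value step certificate**: if the checker accepts, every solution `z`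
of `y' = P(y)` from any `x ∈ W` on `[0, h]` satisfies `z(h) ∈ mvEndBox = endBox(m) + J1·(W − m)`
(Moore's mean value extension of the flow map) and `z(h) ∈ endBox` (the direct Taylor
enclosure). [cite: Moore1979, §4.3 eq. (4.19)] [cite: MrozekZgliczynski2000, Theorem 7.5]
[cite: Zgliczynski2002C1Lohner, §3 (C¹-Lohner algorithm: the enclosure of ∂φ/∂x(h,[x]))] -/
theorem sound (hc : c.check = true) {x : Fin n → ℝ} (hx : x ∈ boxSet (castBox c.init))
    {z : ℝ → Fin n → ℝ} (hz0 : z 0 = x)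
    (hz : ∀ t ∈ Icc 0 (c.step : ℝ),
      HasDerivWithinAt z (evalVec (fieldMv c.field) (z t)) (Icc 0 (c.step : ℝ)) t) :
    z c.step ∈ boxSet (castBox c.mvEndBox) ∧ z c.step ∈ boxSet (castBox c.toHOE.endBox) := by
  obtain ⟨zc, hzc0, hzc, M, hM, hEq⟩ := meanValue hc hx hz0 hz
  refine ⟨?_, VarStepCert.mem_endBox (check_var hc) hx hz0 hz⟩
  have hp : zc c.step ∈ boxSet (castBox c.pointCert.endBox) :=
    HOEStepCert.mem_endBox (check_point hc) (ratVec_mem_pointBox c.center) hzc0 hzc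
  rw [hEq]
  exact meanValue_mem_mvBoxQ hp hM hx

/-- Every solution from `W` ends in `bestEndBox = mvEndBox ∩ endBox`.
[cite: Moore1979, §4.3 eq. (4.19) and remark after eq. (4.25)] -/
theorem mem_bestEndBox (hc : c.check = true) {x : Fin n → ℝ}
    (hx : x ∈ boxSet (castBox c.init)) {z : ℝ → Fin n → ℝ} (hz0 : z 0 = x)
    (hz : ∀ t ∈ Icc 0 (c.step : ℝ),
      HasDerivWithinAt z (evalVec (fieldMv c.field) (z t)) (Icc 0 (c.step : ℝ)) t) :
    z c.step ∈ boxSet (castBox c.bestEndBox) :=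
  mem_meetBox (sound hc hx hz0 hz).1 (sound hc hx hz0 hz).2

end MVStepCert

end Certificate

/-! ### Packaging as a `Verifier` -/

section VerifierPackaging

variable {n : ℕ}

/-- An instance of the one-step enclosure problem: a polynomial field, a step, a box `W` of
initial values and a claimed box `final ⊇ φ(h, W)`.
[cite: WalawskaWilczak2016, §2 (tighter bounds [x_{k+1}] ⊇ φ(t_k + h_k, [x_0]))] -/
structure MVInstance (n : ℕ) where
  /-- The polynomial vector field. -/
  field : Fin n → QMvPoly
  /-- The step size `h`. -/
  step : ℚ
  /-- The box `W` of initial values. -/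
  init : Fin n → NonemptyInterval ℚ
  /-- The claimed enclosure of `φ(h, W)`. -/
  final : Fin n → NonemptyInterval ℚ

/-- The claim certified for an instance: from every `x ∈ W` a solution exists on `[0, h]`, and
every solution from `x` ends in `final` at time `h`.
[cite: WalawskaWilczak2016, §2 (tighter bounds [x_{k+1}] ⊇ φ(t_k + h_k, [x_0]))] -/
def MVInstance.Claim (I : MVInstance n) : Prop :=
  ∀ x ∈ boxSet (castBox I.init),
    (∃ y : ℝ → Fin n → ℝ, y 0 = x ∧
      ∀ t ∈ Icc 0 (I.step : ℝ),
        HasDerivWithinAt y (evalVec (fieldMv I.field) (y t)) (Icc 0 (I.step : ℝ)) t) ∧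
    ∀ z : ℝ → Fin n → ℝ, z 0 = x →
      (∀ t ∈ Icc 0 (I.step : ℝ),
        HasDerivWithinAt z (evalVec (fieldMv I.field) (z t)) (Icc 0 (I.step : ℝ)) t) →
      z I.step ∈ boxSet (castBox I.final)

/-- The certificate data of the mean value step verifier: order, a-priori boxes, centre data.
[cite: NedialkovJacksonCorliss1999, §5 Algorithm I] -/
structure MVCertData (n : ℕ) where
  /-- The order `K` of the Taylor enclosures on `W`. -/
  order : ℕ
  /-- The a-priori state box `S`. -/
  apriori : Fin n → NonemptyInterval ℚ
  /-- The a-priori Jacobian box `VV`. -/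
  jacApriori : Fin n → Fin n → NonemptyInterval ℚ
  /-- The centre `m`. -/
  center : Fin n → ℚ
  /-- The order of the point enclosure from the centre. -/
  centerOrder : ℕ
  /-- The a-priori box of the solution from the centre. -/
  centerApriori : Fin n → NonemptyInterval ℚ

/-- The instance together with certificate data, as a mean value step certificate.
[cite: NedialkovJacksonCorliss1999, §5 Algorithm I] -/
def MVInstance.withData (I : MVInstance n) (d : MVCertData n) : MVStepCert n where
  field := I.field
  order := d.order
  step := I.step
  init := I.init
  apriori := d.apriori
  jacApriori := d.jacApriori
  center := d.center
  centerOrder := d.centerOrder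
  centerApriori := d.centerApriori

/-- **The mean value step verifier** in the sense of `ValidatedNumerics.Verifier`: the checker
runs `MVStepCert.check` and tests `bestEndBox ≤ final`; soundness is `MVStepCert.exists_of_check`
and `MVStepCert.mem_bestEndBox`. [cite: Moore1979, §4.3 eq. (4.19)]
[cite: WalawskaWilczak2016, §2 (tighter bounds [x_{k+1}] ⊇ φ(t_k + h_k, [x_0]))] -/
def mvStepVerifier (n : ℕ) : Verifier (MVInstance n) MVInstance.Claim where
  Cert := MVCertData n
  check I d := (I.withData d).check && boxLE (I.withData d).bestEndBox I.final
  sound I d h := by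
    simp only [Bool.and_eq_true] at h
    intro x hx
    exact ⟨MVStepCert.exists_of_check (c := I.withData d) h.1 hx, fun z hz0 hz =>
      boxSet_mono (castBox_mono (le_of_boxLE h.2))
        (MVStepCert.mem_bestEndBox (c := I.withData d) h.1 hx hz0 hz)⟩

end VerifierPackaging

/-! ### Moore's Volterra example from a box of initial values, replayed by the kernel -/

section MooreExample

/-- **The mean value step for Moore's Volterra system (8.6)** `x₁' = 2x₁(1 − x₂)`,
`x₂' = −x₂(1 − x₁)` from the BOX `W = [0.99, 1.01] × [2.99, 3.01]`, step `h = 0.125`, order `6`,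
centre `m = (1, 3)` (order `6`), with the a-priori boxes `S = [0.4357, 1.1659] × [2.8803, 3.0398]`,
`VV = ([0.4033, 1.1866], [−0.3368, 0.1849]; [−0.1605, 0.4436], [0.8947, 1.0448])` (row-wise) and
`S_m = [0.465, 1.1459] × [2.9012, 3.0204]` found by the untrusted inflate-and-retest stage.
[cite: Moore1979, §8.1 eqs. (8.6)–(8.8)] [cite: Moore1979, §4.3 eq. (4.19)] -/
def mooreVolterraMV : MVStepCert 2 where
  field := volterraField
  order := 6
  step := 1 / 8
  init := ![⟨(99 / 100, 101 / 100), by decide +kernel⟩, ⟨(299 / 100, 301 / 100), by decide +kernel⟩]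
  apriori := ![⟨(4357 / 10000, 11659 / 10000), by decide +kernel⟩,
    ⟨(28803 / 10000, 30398 / 10000), by decide +kernel⟩]
  jacApriori :=
    ![![⟨(4033 / 10000, 11866 / 10000), by decide +kernel⟩,
        ⟨(-3368 / 10000, 1849 / 10000), by decide +kernel⟩],
      ![⟨(-1605 / 10000, 4436 / 10000), by decide +kernel⟩,
        ⟨(8947 / 10000, 10448 / 10000), by decide +kernel⟩]]
  center := ![1, 3]
  centerOrder := 6
  centerApriori := ![⟨(4650 / 10000, 11459 / 10000), by decide +kernel⟩,
    ⟨(29012 / 10000, 30204 / 10000), by decide +kernel⟩]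

/-- The kernel accepts the mean value step certificate: the `C¹` tests on `W`, `posBox S`,
`m ∈ W` and the point test from the centre all hold in exact rational interval arithmetic.
[cite: Moore1979, §4.3 eq. (4.19)] [cite: WalawskaWilczak2016, §2.1 (C¹ high-order enclosure)] -/
theorem mooreVolterraMV_check : mooreVolterraMV.check = true := by
  decide +kernel

/-- The certified mean value end box is contained in `[0.5978, 0.6237] × [2.9068, 2.9363]`
(widths `0.026`, `0.030`; kernel computation). [cite: Moore1979, §4.3 eq. (4.19)] -/
theorem mooreVolterraMV_mvEndBox_le :
    boxLE mooreVolterraMV.mvEndBox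
      ![⟨(5978 / 10000, 6237 / 10000), by decide +kernel⟩,
        ⟨(29068 / 10000, 29363 / 10000), by decide +kernel⟩] = true := by
  decide +kernel

/-- For comparison, the DIRECT Taylor end box of the same step (order `6` over the whole box `W`)
contains `[0.5687, 0.6529] × [2.8975, 2.9456]` (widths `≥ 0.084`, `0.048`): on this example the
mean value form is about three times narrower (kernel computation).
[cite: Moore1979, §4.3 (remark after eq. (4.25)) and §8.2 (wrapping effect)] -/
theorem mooreVolterraMV_directEndBox_ge :
    boxLE ![⟨(5687 / 10000, 6529 / 10000), by decide +kernel⟩,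
        ⟨(28975 / 10000, 29456 / 10000), by decide +kernel⟩]
      mooreVolterraMV.toHOE.endBox = true := by
  decide +kernel

/-- **Enclosure of the flow of a box, certified by the kernel**: every solution of Volterra's
system (8.6) starting in `W = [0.99, 1.01] × [2.99, 3.01]` satisfies
`x(0.125) ∈ [0.5978, 0.6237] × [2.9068, 2.9363]`. [cite: Moore1979, §4.3 eq. (4.19)]
[cite: Moore1979, §8.1 eqs. (8.6)–(8.8)] [cite: MrozekZgliczynski2000, Theorem 7.5] -/
theorem mooreVolterraMV_sound {x : Fin 2 → ℝ} (hx : x ∈ boxSet (castBox mooreVolterraMV.init))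
    {z : ℝ → Fin 2 → ℝ} (hz0 : z 0 = x)
    (hz : ∀ t ∈ Icc (0 : ℝ) (((1 / 8 : ℚ) : ℝ)),
      HasDerivWithinAt z (evalVec (fieldMv volterraField) (z t)) (Icc (0 : ℝ) ((1 / 8 : ℚ) : ℝ)) t) :
    z ((1 / 8 : ℚ) : ℝ) ∈ boxSet (castBox
      ![⟨(5978 / 10000, 6237 / 10000), by decide +kernel⟩,
        ⟨(29068 / 10000, 29363 / 10000), by decide +kernel⟩]) :=
  boxSet_mono (castBox_mono (le_of_boxLE mooreVolterraMV_mvEndBox_le))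
    (MVStepCert.sound mooreVolterraMV_check hx hz0 hz).1

/-- The same step as an instance of the mean value step VERIFIER, its claim extracted from the
kernel's `decide` (existence on `[0, 0.125]` from every point of `W` and
`φ(0.125, W) ⊆ [0.5978, 0.6237] × [2.9068, 2.9363]`). [cite: Moore1979, §4.3 eq. (4.19)]
[cite: WalawskaWilczak2016, §2 (tighter bounds [x_{k+1}] ⊇ φ(t_k + h_k, [x_0]))] -/
theorem mooreVolterraMV_claim :
    MVInstance.Claim (⟨volterraField, 1 / 8,
      ![⟨(99 / 100, 101 / 100), by decide +kernel⟩, ⟨(299 / 100, 301 / 100), by decide +kernel⟩],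
      ![⟨(5978 / 10000, 6237 / 10000), by decide +kernel⟩,
        ⟨(29068 / 10000, 29363 / 10000), by decide +kernel⟩]⟩ : MVInstance 2) :=
  (mvStepVerifier 2).sound
    (c := (⟨6, mooreVolterraMV.apriori, mooreVolterraMV.jacApriori, ![1, 3], 6,
      mooreVolterraMV.centerApriori⟩ : MVCertData 2))
    (by decide +kernel)

end MooreExample

end Literature.Analysis.ODE
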